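import Summits.RiemannHypothesis.RiemannHypothesis.Theorems.WeilFormatCCinfFactsOddTruncA
import HarnessLib

/-!
# Format C, design C∞: NAMES for the odd sector's row families, profile table and row remainder (cut at power `E₀`)

Route context: Fourier–Galerkin / Schur-complement certificates of Weil positivity on a window ("format C", C∞ door;
cell memo `run/shared/lean/pub/rh-explicit/rh-explicit-weil-10/KERNEL-LEVER.md` §22–§23; supporting stmt-RiemannHypothesis-0098;
seat rh-explicit-weil-10).  `cinf_facts_odd_truncA` (`WeilFormatCCinfFactsOddTruncA`) proves the C∞ doors' hypotheses
`hρrowo ∧ hrowo ∧ hVo ∧ hWo` for EXPLICIT printed functions `Prowo`, `ρrowo`, `Rtabo` (multi-kilobyte lambdas).  The rung's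
data side (rh-explicit-weil-2's exact-integer stage pipeline `CinfStageO.SR …` and the `TabNear` validators of the
tables `PR`, `RT`, `RR`) must name the SAME functions.  This file gives them names, so that every downstream statement carries
an identifier instead of the printed lambda and the door's `_`-slots unify syntactically:

* `CinfFam.prowRawO` — the (tag, power) coefficient of the block row with kernel index `ii` (mode `ii+1`) (un-rescaled), with the per-tag
  projections `prowRawO_tag0/1/2/3` (`rfl`): tag 0 = the pure fiber sum boxed by `CinfCoeff.mem_oddRowPureBox`, tag 3 = the
  `S_m` fiber sum of `CinfCoeff.mem_oddRowSinBox`, tags 1, 2 = 0;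
* `CinfFam.prowO` — the door's `Prowo` (rescaled and truncated: `raw(t, e+1)/m₀^{e+1}` with threshold `m₀+1`), `prowO_apply`;
* `CinfFam.rtabRawO`, `CinfFam.rtabO` — the door's `Rtabo`, `rtabO_apply`, `rtabRawO_tag0`;
* `CinfFam.rhoRowO` — the door's `ρrowo` (analytic remainder + truncation tail), `rhoRowO_eq`;
* `cinf_facts_odd_truncA_fam` — `cinf_facts_odd_truncA` RESTATED through the names (same hypotheses, same order).

Definitions are verbatim copies of the printed lambdas (generated from the tree file by
`HOME/rh-explicit-weil-10/lean/gen12/gen/make_famdefs.py`); proofs `rfl` / `exact`.  Standard axioms; no RH claim.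
-/

set_option autoImplicit false
-- `Summit.RiemannHypothesis.RiemannHypothesis.…` is the layout-mandated namespace (summit = problem name).
set_option linter.dupNamespace false

noncomputable section

open Complex Filter Set MeasureTheory Finset
open scoped Real Topology ComplexConjugate ArithmeticFunction.vonMangoldt

namespace Summit.RiemannHypothesis.RiemannHypothesis.Theorems.WeilFormatC

open Literature.NumberTheory.LFunctions Literature.NumberTheory.LFunctions.Yoshida1992
  Literature.Analysis.SpecialFunctions

namespace CinfFam

/-- The (tag, power)-coefficient function of the odd block row with kernel index `ii` (mode `ii+1`) BEFORE rescaling/truncation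
(`abs_oddRow_sub_family_le`): `prowRawO a ν K R J ii t d` = coefficient of `T_t/m^d`. -/
def prowRawO (a : ℝ) (ν K R J : ℕ) (ii : ℕ) : Fin 4 → ℕ → ℝ :=
  fun t d ↦ (![fun d : ℕ ↦ (∑ j ∈ (Finset.range J).filter (fun j ↦ (2 * j + 2) = d),
                π / 4 * ((-1 : ℝ) ^ (ii + 1) * ((ii + 1 : ℕ) : ℝ) ^ (2 * j + 1)) / Real.pi)
              + (∑ p ∈ (Finset.Icc 1 K ×ˢ Finset.range J).filter (fun p ↦ p.1 + (2 * p.2 + 2) = d),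
                  (fun N : ℕ ↦ (if N % 4 = 1 then (1 : ℝ) else if N % 4 = 3 then -1 else 0)
              * (1 - 1 / (2 * (N : ℝ))
                  - (∑ l ∈ Finset.Icc 1 ν, (bernoulli (2 * l) : ℝ) / (2 * l) * 16 ^ l
                      * (((N - 1).choose (2 * l - 1) : ℕ) : ℝ)) / 2)
              * (a / (2 * π)) ^ N) p.1
                    * ((-1 : ℝ) ^ (ii + 1) * ((ii + 1 : ℕ) : ℝ) ^ (2 * p.2 + 1)) / Real.pi)
              - (∑ p ∈ (Finset.range R ×ˢ Finset.range J).filter (fun p ↦ (2 * p.1 + 1) + (2 * p.2 + 2) = d),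
                  (fun r : ℕ ↦ (-1 : ℝ) ^ r *
              (∑' l : ℕ, Real.exp (-(2 * a * digammaNode l)) * digammaNode l ^ (2 * r)) * (a / π) ^ (2 * r + 1)) p.1
                    * ((-1 : ℝ) ^ (ii + 1) * ((ii + 1 : ℕ) : ℝ) ^ (2 * p.2 + 1)) / Real.pi)
              + (∑ r ∈ (Finset.range J).filter (fun r ↦ (2 * r + 1) = d),
                  (fun r : ℕ ↦ (-1 : ℝ) ^ (ii + 1) *
              (-(((ii + 1 : ℕ) : ℝ) ^ (2 * r)) * ((Complex.digamma (1 / 4 + ((freq a ((ii + 1 : ℕ) : ℤ) : ℝ) : ℂ) / 2 * I)).im / 2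
                  + (∑ k ∈ weilPrimeIndex a, (Λ k : ℝ) / Real.sqrt k * Real.sin (freq a ((ii + 1 : ℕ) : ℤ) * Real.log k))
                  - archExpSumSin a ((ii + 1 : ℕ) : ℤ)) / π
                - 4 * (Real.exp (a / 2) - Real.exp (-(a / 2))) ^ 2 / π * (-1 : ℝ) ^ r * (a ^ 2 / (4 * π ^ 2)) ^ r
                  * (freq a ((ii + 1 : ℕ) : ℤ) / (1 + 4 * freq a ((ii + 1 : ℕ) : ℤ) ^ 2)))) r),
                fun _ ↦ 0, fun _ ↦ 0,
                fun d : ℕ ↦ ∑ j ∈ (Finset.range J).filter (fun j ↦ (2 * j + 2) = d),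
                ((-1 : ℝ) ^ (ii + 1) * ((ii + 1 : ℕ) : ℝ) ^ (2 * j + 1)) / Real.pi] t) d

/-- The door's `Prowo` for the truncated rescaled families over `Fin 4 × Fin E₀` (verbatim from `cinf_facts_odd_truncA`). -/
def prowO (a : ℝ) (ν K R J E₀ m₀ : ℕ) : ℕ → Fin 4 × Fin E₀ → ℝ :=
  fun (ii : ℕ) (x : Fin 4 × Fin E₀) ↦ ((![fun d : ℕ ↦ (∑ j ∈ (Finset.range J).filter (fun j ↦ (2 * j + 2) = d),
                π / 4 * ((-1 : ℝ) ^ (ii + 1) * ((ii + 1 : ℕ) : ℝ) ^ (2 * j + 1)) / Real.pi)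
              + (∑ p ∈ (Finset.Icc 1 K ×ˢ Finset.range J).filter (fun p ↦ p.1 + (2 * p.2 + 2) = d),
                  (fun N : ℕ ↦ (if N % 4 = 1 then (1 : ℝ) else if N % 4 = 3 then -1 else 0)
              * (1 - 1 / (2 * (N : ℝ))
                  - (∑ l ∈ Finset.Icc 1 ν, (bernoulli (2 * l) : ℝ) / (2 * l) * 16 ^ l
                      * (((N - 1).choose (2 * l - 1) : ℕ) : ℝ)) / 2)
              * (a / (2 * π)) ^ N) p.1
                    * ((-1 : ℝ) ^ (ii + 1) * ((ii + 1 : ℕ) : ℝ) ^ (2 * p.2 + 1)) / Real.pi)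
              - (∑ p ∈ (Finset.range R ×ˢ Finset.range J).filter (fun p ↦ (2 * p.1 + 1) + (2 * p.2 + 2) = d),
                  (fun r : ℕ ↦ (-1 : ℝ) ^ r *
              (∑' l : ℕ, Real.exp (-(2 * a * digammaNode l)) * digammaNode l ^ (2 * r)) * (a / π) ^ (2 * r + 1)) p.1
                    * ((-1 : ℝ) ^ (ii + 1) * ((ii + 1 : ℕ) : ℝ) ^ (2 * p.2 + 1)) / Real.pi)
              + (∑ r ∈ (Finset.range J).filter (fun r ↦ (2 * r + 1) = d),
                  (fun r : ℕ ↦ (-1 : ℝ) ^ (ii + 1) *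
              (-(((ii + 1 : ℕ) : ℝ) ^ (2 * r)) * ((Complex.digamma (1 / 4 + ((freq a ((ii + 1 : ℕ) : ℤ) : ℝ) : ℂ) / 2 * I)).im / 2
                  + (∑ k ∈ weilPrimeIndex a, (Λ k : ℝ) / Real.sqrt k * Real.sin (freq a ((ii + 1 : ℕ) : ℤ) * Real.log k))
                  - archExpSumSin a ((ii + 1 : ℕ) : ℤ)) / π
                - 4 * (Real.exp (a / 2) - Real.exp (-(a / 2))) ^ 2 / π * (-1 : ℝ) ^ r * (a ^ 2 / (4 * π ^ 2)) ^ r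
                  * (freq a ((ii + 1 : ℕ) : ℤ) / (1 + 4 * freq a ((ii + 1 : ℕ) : ℤ) ^ 2)))) r),
                fun _ ↦ 0, fun _ ↦ 0,
                fun d : ℕ ↦ ∑ j ∈ (Finset.range J).filter (fun j ↦ (2 * j + 2) = d),
                ((-1 : ℝ) ^ (ii + 1) * ((ii + 1 : ℕ) : ℝ) ^ (2 * j + 1)) / Real.pi] x.1) ((x.2 : ℕ) + 1) / ((m₀ + 1 : ℕ) : ℝ) ^ ((x.2 : ℕ) + 1))

/-- The door's `ρrowo`: analytic remainder at orders `(ν, K, R, J)` plus the truncation tail beyond power `E₀`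
(verbatim from `cinf_facts_odd_truncA`). -/
def rhoRowO (a : ℝ) (ν K R J D E₀ m₀ : ℕ) : ℕ → ℝ :=
  fun ii : ℕ ↦ (((4 * Real.pi ^ 2 / 3 * ((2 * ν + 1).factorial : ℝ) / (2 * Real.pi) ^ (2 * ν + 1)
                * (4 * (1 / (4 * (π * ((m₀ + 1 : ℕ) : ℝ) / a / 2)))) ^ (2 * ν)
              + (1 / (4 * (π * ((m₀ + 1 : ℕ) : ℝ) / a / 2))) ^ (K + 1) / ((K + 1) * (1 - 1 / (4 * (π * ((m₀ + 1 : ℕ) : ℝ) / a / 2))))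
              + 2 * (1 / (4 * (π * ((m₀ + 1 : ℕ) : ℝ) / a / 2))) ^ (K + 1)
              + ∑ k ∈ Finset.Icc 1 ν, |(bernoulli (2 * k) : ℝ) / (2 * k)| * 2 ^ (K + 1 + 4 * k)
                  * (1 / (4 * (π * ((m₀ + 1 : ℕ) : ℝ) / a / 2))) ^ (K + 1)) / 2
            + (∑' k : ℕ, Real.exp (-(2 * a * digammaNode k)) * digammaNode k ^ (2 * R))
                / |π * ((m₀ + 1 : ℕ) : ℝ) / a| ^ (2 * R + 1)) / π
            * ∑ j ∈ Finset.range J, ((ii + 1 : ℕ) : ℝ) ^ (2 * j + 1) / ((m₀ + 1 : ℕ) : ℝ) ^ (2 * j + 2)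
          + (2 * (π / 4 + (∑ k ∈ weilPrimeIndex a, (Λ k : ℝ) / Real.sqrt k) + a * (1 + weilArchDensity (2 * a)) / π)
                * ((ii + 1 : ℕ) : ℝ) ^ (2 * J) / π
              + 4 * (Real.exp (a / 2) - Real.exp (-(a / 2))) ^ 2 / π * (a ^ 2 / (4 * π ^ 2)) ^ J
                * (freq a ((ii + 1 : ℕ) : ℤ) / (1 + 4 * freq a ((ii + 1 : ℕ) : ℤ) ^ 2))) / ((m₀ + 1 : ℕ) : ℝ) ^ (2 * J + 1))
        + ∑ x : Fin 4 × Fin (D + 1), if E₀ < (x.2 : ℕ) then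
          |(fun t d ↦ (![fun d : ℕ ↦ (∑ j ∈ (Finset.range J).filter (fun j ↦ (2 * j + 2) = d),
                π / 4 * ((-1 : ℝ) ^ (ii + 1) * ((ii + 1 : ℕ) : ℝ) ^ (2 * j + 1)) / Real.pi)
              + (∑ p ∈ (Finset.Icc 1 K ×ˢ Finset.range J).filter (fun p ↦ p.1 + (2 * p.2 + 2) = d),
                  (fun N : ℕ ↦ (if N % 4 = 1 then (1 : ℝ) else if N % 4 = 3 then -1 else 0)
              * (1 - 1 / (2 * (N : ℝ))
                  - (∑ l ∈ Finset.Icc 1 ν, (bernoulli (2 * l) : ℝ) / (2 * l) * 16 ^ l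
                      * (((N - 1).choose (2 * l - 1) : ℕ) : ℝ)) / 2)
              * (a / (2 * π)) ^ N) p.1
                    * ((-1 : ℝ) ^ (ii + 1) * ((ii + 1 : ℕ) : ℝ) ^ (2 * p.2 + 1)) / Real.pi)
              - (∑ p ∈ (Finset.range R ×ˢ Finset.range J).filter (fun p ↦ (2 * p.1 + 1) + (2 * p.2 + 2) = d),
                  (fun r : ℕ ↦ (-1 : ℝ) ^ r *
              (∑' l : ℕ, Real.exp (-(2 * a * digammaNode l)) * digammaNode l ^ (2 * r)) * (a / π) ^ (2 * r + 1)) p.1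
                    * ((-1 : ℝ) ^ (ii + 1) * ((ii + 1 : ℕ) : ℝ) ^ (2 * p.2 + 1)) / Real.pi)
              + (∑ r ∈ (Finset.range J).filter (fun r ↦ (2 * r + 1) = d),
                  (fun r : ℕ ↦ (-1 : ℝ) ^ (ii + 1) *
              (-(((ii + 1 : ℕ) : ℝ) ^ (2 * r)) * ((Complex.digamma (1 / 4 + ((freq a ((ii + 1 : ℕ) : ℤ) : ℝ) : ℂ) / 2 * I)).im / 2
                  + (∑ k ∈ weilPrimeIndex a, (Λ k : ℝ) / Real.sqrt k * Real.sin (freq a ((ii + 1 : ℕ) : ℤ) * Real.log k))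
                  - archExpSumSin a ((ii + 1 : ℕ) : ℤ)) / π
                - 4 * (Real.exp (a / 2) - Real.exp (-(a / 2))) ^ 2 / π * (-1 : ℝ) ^ r * (a ^ 2 / (4 * π ^ 2)) ^ r
                  * (freq a ((ii + 1 : ℕ) : ℤ) / (1 + 4 * freq a ((ii + 1 : ℕ) : ℤ) ^ 2)))) r),
                fun _ ↦ 0, fun _ ↦ 0,
                fun d : ℕ ↦ ∑ j ∈ (Finset.range J).filter (fun j ↦ (2 * j + 2) = d),
                ((-1 : ℝ) ^ (ii + 1) * ((ii + 1 : ℕ) : ℝ) ^ (2 * j + 1)) / Real.pi] t) d) x.1 x.2| * (![(1 : ℝ), ((m₀ + 1 : ℕ) : ℝ), ∑ n ∈ weilPrimeIndex a, (Λ n : ℝ) / Real.sqrt n, ∑ n ∈ weilPrimeIndex a, (Λ n : ℝ) / Real.sqrt n] x.1) / ((m₀ + 1 : ℕ) : ℝ) ^ (x.2 : ℕ) else 0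

/-- The (tag, power)-coefficient function of the profile table row `j` BEFORE rescaling (only tag 0 is nonzero). -/
def rtabRawO (a : ℝ) (so : Finset ℕ) {ro : ℕ} (coefo : Fin ro → ℕ → ℝ) (j : Fin ro) : Fin 4 → ℕ → ℝ :=
  fun t d ↦ (![fun d : ℕ ↦ ∑ p ∈ (so.sigma fun q ↦ Finset.range (q + 1)).filter (fun p ↦ p.2 + 1 = d),
              2 * coefo j p.1 * ((-1 : ℝ) ^ p.2 * (p.1.descFactorial p.2 : ℝ) * (a ^ (p.1 - p.2) - (-a) ^ (p.1 - p.2))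
                * (a / π) ^ (p.2 + 1) * (I ^ (p.2 + 1)).im) / Real.sqrt (2 * a),
              fun _ ↦ 0, fun _ ↦ 0, fun _ ↦ 0] t) d

/-- The door's `Rtabo` for the truncated rescaled families (verbatim from `cinf_facts_odd_truncA`). -/
def rtabO (a : ℝ) (so : Finset ℕ) {ro : ℕ} (coefo : Fin ro → ℕ → ℝ) (E₀ m₀ : ℕ) : Fin ro → Fin 4 × Fin E₀ → ℝ :=
  fun (j : Fin ro) (x : Fin 4 × Fin E₀) ↦ ((![fun d : ℕ ↦ ∑ p ∈ (so.sigma fun q ↦ Finset.range (q + 1)).filter (fun p ↦ p.2 + 1 = d),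
              2 * coefo j p.1 * ((-1 : ℝ) ^ p.2 * (p.1.descFactorial p.2 : ℝ) * (a ^ (p.1 - p.2) - (-a) ^ (p.1 - p.2))
                * (a / π) ^ (p.2 + 1) * (I ^ (p.2 + 1)).im) / Real.sqrt (2 * a),
              fun _ ↦ 0, fun _ ↦ 0, fun _ ↦ 0] x.1) ((x.2 : ℕ) + 1) / ((m₀ + 1 : ℕ) : ℝ) ^ ((x.2 : ℕ) + 1))

variable (a : ℝ) (ν K R J D E₀ m₀ : ℕ)

/-- `prowO` through `prowRawO`. -/
theorem prowO_apply (ii : ℕ) (x : Fin 4 × Fin E₀) :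
    prowO a ν K R J E₀ m₀ ii x = prowRawO a ν K R J ii x.1 ((x.2 : ℕ) + 1) / ((m₀ + 1 : ℕ) : ℝ) ^ ((x.2 : ℕ) + 1) := rfl

/-- Tag 0 (pure powers) of `prowRawO`: the fiber sum boxed by `CinfCoeff.mem_oddRowPureBox`. -/
theorem prowRawO_tag0 (ii d : ℕ) : prowRawO a ν K R J ii 0 d = (∑ j ∈ (Finset.range J).filter (fun j ↦ (2 * j + 2) = d),
                  π / 4 * ((-1 : ℝ) ^ (ii + 1) * ((ii + 1 : ℕ) : ℝ) ^ (2 * j + 1)) / Real.pi)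
                + (∑ p ∈ (Finset.Icc 1 K ×ˢ Finset.range J).filter (fun p ↦ p.1 + (2 * p.2 + 2) = d),
                    (fun N : ℕ ↦ (if N % 4 = 1 then (1 : ℝ) else if N % 4 = 3 then -1 else 0)
                * (1 - 1 / (2 * (N : ℝ))
                    - (∑ l ∈ Finset.Icc 1 ν, (bernoulli (2 * l) : ℝ) / (2 * l) * 16 ^ l
                        * (((N - 1).choose (2 * l - 1) : ℕ) : ℝ)) / 2)
                * (a / (2 * π)) ^ N) p.1
                      * ((-1 : ℝ) ^ (ii + 1) * ((ii + 1 : ℕ) : ℝ) ^ (2 * p.2 + 1)) / Real.pi)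
                - (∑ p ∈ (Finset.range R ×ˢ Finset.range J).filter (fun p ↦ (2 * p.1 + 1) + (2 * p.2 + 2) = d),
                    (fun r : ℕ ↦ (-1 : ℝ) ^ r *
                (∑' l : ℕ, Real.exp (-(2 * a * digammaNode l)) * digammaNode l ^ (2 * r)) * (a / π) ^ (2 * r + 1)) p.1
                      * ((-1 : ℝ) ^ (ii + 1) * ((ii + 1 : ℕ) : ℝ) ^ (2 * p.2 + 1)) / Real.pi)
                + (∑ r ∈ (Finset.range J).filter (fun r ↦ (2 * r + 1) = d),
                    (fun r : ℕ ↦ (-1 : ℝ) ^ (ii + 1) *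
                (-(((ii + 1 : ℕ) : ℝ) ^ (2 * r)) * ((Complex.digamma (1 / 4 + ((freq a ((ii + 1 : ℕ) : ℤ) : ℝ) : ℂ) / 2 * I)).im / 2
                    + (∑ k ∈ weilPrimeIndex a, (Λ k : ℝ) / Real.sqrt k * Real.sin (freq a ((ii + 1 : ℕ) : ℤ) * Real.log k))
                    - archExpSumSin a ((ii + 1 : ℕ) : ℤ)) / π
                  - 4 * (Real.exp (a / 2) - Real.exp (-(a / 2))) ^ 2 / π * (-1 : ℝ) ^ r * (a ^ 2 / (4 * π ^ 2)) ^ r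
                    * (freq a ((ii + 1 : ℕ) : ℤ) / (1 + 4 * freq a ((ii + 1 : ℕ) : ℤ) ^ 2)))) r) := rfl

/-- Tag 1 (`log m`) of `prowRawO` vanishes. -/
theorem prowRawO_tag1 (ii d : ℕ) : prowRawO a ν K R J ii 1 d = 0 := rfl

/-- Tag 2 (`−C_m`) of `prowRawO` vanishes. -/
theorem prowRawO_tag2 (ii d : ℕ) : prowRawO a ν K R J ii 2 d = 0 := rfl

/-- Tag 3 (`S_m`) of `prowRawO`: the fiber sum boxed by `CinfCoeff.mem_oddRowSinBox`. -/
theorem prowRawO_tag3 (ii d : ℕ) : prowRawO a ν K R J ii 3 d = ∑ j ∈ (Finset.range J).filter (fun j ↦ (2 * j + 2) = d),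
                  ((-1 : ℝ) ^ (ii + 1) * ((ii + 1 : ℕ) : ℝ) ^ (2 * j + 1)) / Real.pi := rfl

/-- `rhoRowO` = analytic remainder + truncation tail written with `prowRawO`. -/
theorem rhoRowO_eq (ii : ℕ) : rhoRowO a ν K R J D E₀ m₀ ii = (((4 * Real.pi ^ 2 / 3 * ((2 * ν + 1).factorial : ℝ) / (2 * Real.pi) ^ (2 * ν + 1)
                * (4 * (1 / (4 * (π * ((m₀ + 1 : ℕ) : ℝ) / a / 2)))) ^ (2 * ν)
              + (1 / (4 * (π * ((m₀ + 1 : ℕ) : ℝ) / a / 2))) ^ (K + 1) / ((K + 1) * (1 - 1 / (4 * (π * ((m₀ + 1 : ℕ) : ℝ) / a / 2))))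
              + 2 * (1 / (4 * (π * ((m₀ + 1 : ℕ) : ℝ) / a / 2))) ^ (K + 1)
              + ∑ k ∈ Finset.Icc 1 ν, |(bernoulli (2 * k) : ℝ) / (2 * k)| * 2 ^ (K + 1 + 4 * k)
                  * (1 / (4 * (π * ((m₀ + 1 : ℕ) : ℝ) / a / 2))) ^ (K + 1)) / 2
            + (∑' k : ℕ, Real.exp (-(2 * a * digammaNode k)) * digammaNode k ^ (2 * R))
                / |π * ((m₀ + 1 : ℕ) : ℝ) / a| ^ (2 * R + 1)) / π
            * ∑ j ∈ Finset.range J, ((ii + 1 : ℕ) : ℝ) ^ (2 * j + 1) / ((m₀ + 1 : ℕ) : ℝ) ^ (2 * j + 2)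
          + (2 * (π / 4 + (∑ k ∈ weilPrimeIndex a, (Λ k : ℝ) / Real.sqrt k) + a * (1 + weilArchDensity (2 * a)) / π)
                * ((ii + 1 : ℕ) : ℝ) ^ (2 * J) / π
              + 4 * (Real.exp (a / 2) - Real.exp (-(a / 2))) ^ 2 / π * (a ^ 2 / (4 * π ^ 2)) ^ J
                * (freq a ((ii + 1 : ℕ) : ℤ) / (1 + 4 * freq a ((ii + 1 : ℕ) : ℤ) ^ 2))) / ((m₀ + 1 : ℕ) : ℝ) ^ (2 * J + 1))
        + ∑ x : Fin 4 × Fin (D + 1), if E₀ < (x.2 : ℕ) then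
          |prowRawO a ν K R J ii x.1 x.2| * (![(1 : ℝ), ((m₀ + 1 : ℕ) : ℝ), ∑ n ∈ weilPrimeIndex a, (Λ n : ℝ) / Real.sqrt n, ∑ n ∈ weilPrimeIndex a, (Λ n : ℝ) / Real.sqrt n] x.1) / ((m₀ + 1 : ℕ) : ℝ) ^ (x.2 : ℕ) else 0 := rfl

/-- `rtabO` through `rtabRawO`. -/
theorem rtabO_apply (so : Finset ℕ) {ro : ℕ} (coefo : Fin ro → ℕ → ℝ) (j : Fin ro) (x : Fin 4 × Fin E₀) :
    rtabO a so coefo E₀ m₀ j x = rtabRawO a so coefo j x.1 ((x.2 : ℕ) + 1) / ((m₀ + 1 : ℕ) : ℝ) ^ ((x.2 : ℕ) + 1) := rfl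

/-- Tag 0 of `rtabRawO`: the profile's Fourier fiber sum (`oddVTable_family`). -/
theorem rtabRawO_tag0 (so : Finset ℕ) {ro : ℕ} (coefo : Fin ro → ℕ → ℝ) (j : Fin ro) (d : ℕ) :
    rtabRawO a so coefo j 0 d = ∑ p ∈ (so.sigma fun q ↦ Finset.range (q + 1)).filter (fun p ↦ p.2 + 1 = d),
                2 * coefo j p.1 * ((-1 : ℝ) ^ p.2 * (p.1.descFactorial p.2 : ℝ) * (a ^ (p.1 - p.2) - (-a) ^ (p.1 - p.2))
                  * (a / π) ^ (p.2 + 1) * (I ^ (p.2 + 1)).im) / Real.sqrt (2 * a) := rfl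

/-- Tags 1, 2, 3 of `rtabRawO` vanish. -/
theorem rtabRawO_tag_succ (so : Finset ℕ) {ro : ℕ} (coefo : Fin ro → ℕ → ℝ) (j : Fin ro) (d : ℕ) :
    rtabRawO a so coefo j 1 d = 0 ∧ rtabRawO a so coefo j 2 d = 0 ∧ rtabRawO a so coefo j 3 d = 0 :=
  ⟨rfl, rfl, rfl⟩

end CinfFam

variable {a : ℝ}

set_option maxHeartbeats 400000 in
/-- **`cinf_facts_odd_truncA` through the names** `CinfFam.prowO / rhoRowO / rtabO`: the C∞ doors' `hρrowo ∧ hrowo ∧ hVo ∧ hWo`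
(the door infers `Prowo := CinfFam.prowO a ν K R J E₀ m₀`, `ρrowo := CinfFam.rhoRowO a ν K R J D E₀ m₀`,
`Rtabo := CinfFam.rtabO a so coefo E₀ m₀` from it when passed `_`). -/
theorem cinf_facts_odd_truncA_fam (ha : 0 < a) {Bo ro m₀ : ℕ} (hm₀ : 2 ≤ π * ((m₀ + 1 : ℕ) : ℝ) / a) (hB2 : 2 * Bo ≤ m₀ + 1) (hm₀1 : 1 ≤ m₀)
    (so : Finset ℕ) (coefo : Fin ro → ℕ → ℝ)
    {ν : ℕ} (hν : ν ≠ 0) {K : ℕ} (hK : 2 * ν ≤ K) {R J E D : ℕ} (hE1 : E + 1 ≤ 2 * ν)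
    (hE2 : E ≤ K) (hE3 : E ≤ 2 * R) (hEJ : E ≤ 2 * J) (hD1 : K + 2 * J ≤ D) (hD2 : 2 * R + 2 * J ≤ D + 1)
    {E₀ : ℕ} (hE0 : E + 1 ≤ E₀) (hE0D : E₀ ≤ D) (hDq : ∀ q ∈ so, q + 1 ≤ E₀) :
    -- hρrowo
    (∀ ii : ℕ, 0 ≤ CinfFam.rhoRowO a ν K R J D E₀ m₀ ii)
    ∧ -- hrowo
    (∀ m, m₀ ≤ m → ∀ ii, ii < Bo →
      |((gramCoeff a ((ii + 1 : ℕ) : ℤ) ((m + 1 : ℕ) : ℤ) - gramCoeff a ((ii + 1 : ℕ) : ℤ) (-((m + 1 : ℕ) : ℤ))) / 2)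
        - (-1 : ℝ) ^ (m + 1) * ∑ f : Fin 4 × Fin E₀, CinfFam.prowO a ν K R J E₀ m₀ ii f
            * (fun (x : Fin 4 × Fin E₀) (m : ℕ) ↦ ![(1 : ℝ), Real.log ((m + 1 : ℕ) : ℝ), -(∑ n ∈ weilPrimeIndex a, (Λ n : ℝ) / Real.sqrt n * Real.cos (π * ((m + 1 : ℕ) : ℝ) / a * Real.log n)), (∑ n ∈ weilPrimeIndex a, (Λ n : ℝ) / Real.sqrt n * Real.sin (π * ((m + 1 : ℕ) : ℝ) / a * Real.log n))] x.1 * (((m₀ + 1 : ℕ) : ℝ) / ((m + 1 : ℕ) : ℝ)) ^ ((x.2 : ℕ) + 1)) f m|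
        ≤ CinfFam.rhoRowO a ν K R J D E₀ m₀ ii * (fun m : ℕ ↦ (((m₀ + 1 : ℕ) : ℝ) / ((m + 1 : ℕ) : ℝ)) ^ (E + 1)) m)
    ∧ -- hVo
    (∀ m, m₀ ≤ m → ∀ j : Fin ro,
      (2 * (Yoshida1992.fourierCoeff a ((m + 1 : ℕ) : ℤ) ((Icc (-a) a).indicator fun x : ℝ ↦ ∑ q ∈ so, ((coefo j q : ℝ) : ℂ) * ((x : ℂ)) ^ q)).im / Real.sqrt (2 * a))
        = (-1 : ℝ) ^ (m + 1) * ∑ f : Fin 4 × Fin E₀, CinfFam.rtabO a so coefo E₀ m₀ j f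
            * (fun (x : Fin 4 × Fin E₀) (m : ℕ) ↦ ![(1 : ℝ), Real.log ((m + 1 : ℕ) : ℝ), -(∑ n ∈ weilPrimeIndex a, (Λ n : ℝ) / Real.sqrt n * Real.cos (π * ((m + 1 : ℕ) : ℝ) / a * Real.log n)), (∑ n ∈ weilPrimeIndex a, (Λ n : ℝ) / Real.sqrt n * Real.sin (π * ((m + 1 : ℕ) : ℝ) / a * Real.log n))] x.1 * (((m₀ + 1 : ℕ) : ℝ) / ((m + 1 : ℕ) : ℝ)) ^ ((x.2 : ℕ) + 1)) f m)
    ∧ -- hWo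
    (∀ N, ∑ m ∈ Ico m₀ N, ((fun m : ℕ ↦ (((m₀ + 1 : ℕ) : ℝ) / ((m + 1 : ℕ) : ℝ)) ^ (E + 1)) m) ^ 2
        ≤ (((m₀ + 1 : ℕ) : ℝ)) ^ (2 * E + 2) / ((2 * E + 1 : ℝ) * ((((m₀ + 1 - 1 : ℕ)) : ℝ)) ^ (2 * E + 1))) := by
  exact cinf_facts_odd_truncA ha hm₀ hB2 hm₀1 so coefo hν hK hE1 hE2 hE3 hEJ hD1 hD2 hE0 hE0D hDq

end Summit.RiemannHypothesis.RiemannHypothesis.Theorems.WeilFormatC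

end
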